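import Mathlib.Analysis.SpecialFunctions.Pow.Real
import Literature.RepresentationTheory.FiniteGroups.IrreducibleCharacters
import Literature.RepresentationTheory.FiniteGroups.WedderburnBlocks
import Literature.Computability.AlgebraicComplexity.STPPWreathTPP
import HarnessLib

/-!
# `Σⱼ cⱼ^s ≤ d_max^{s−2}|G|` and CKSU's Lemma 2 on wreath-product character degrees (abelian case)

Topic `Literature/Computability/AlgebraicComplexity` (group-theoretic matrix multiplication), namespace
`Literature.Computability.AlgebraicComplexity`; companion of `STPPWreathTPP.lean` (`SymWreath H n = Sym_n ⋉ Hⁿ`,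
`maxCharDegree_symWreath_le : d_max ≤ n!`, `card_symWreath`).

* The step used in Cohn–Umans 2003, Cor. 4.2 (arXiv:math/0307321, Cor. 8, p. 6 of the held text): "`Σᵢ dᵢ^{ω−2}dᵢ²
  ≤ |G|^{(ω−2)/γ} Σᵢ dᵢ² = |G|^{1+(ω−2)/γ}`" (`|G|^{1/γ}` = the largest degree), i.e. for every real `s ≥ 2`:
  `Σ_χ χ(1)^s ≤ d_max^{s−2} · |G|` (`charDegreePowSum_le_maxCharDegree_rpow_mul_card`, from the tree's discharged
  `∑ χ(1)² = |G|`, `sum_sq_charDegrees_holds`).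
* Cohn–Kleinberg–Szegedy–Umans 2005 (arXiv:math/0511460), **Lemma 2 (arXiv numbering)**: "Let `{d_k}` be the
  character degrees of a finite group `H` and let `{c_j}` be the character degrees of `Sym_n ⋉ Hⁿ` … Then
  `Σ_j c_j^ω ≤ (n!)^{ω−1} (Σ_k d_k^ω)ⁿ`. *Sketch of proof.* When `H` is abelian, the theorem follows from the
  elementary facts that the character degrees of `Sym_n ⋉ Hⁿ` are at most `n!` (which is the index of `Hⁿ` in
  `Sym_n ⋉ Hⁿ`) and that `Σ_j c_j² = |Sym_n ⋉ Hⁿ|`." — the ABELIAN case exactly as sketched, for every real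
  exponent `s ≥ 2` (`Σ_k d_k^s = |H|` for abelian `H`): `CohnKleinbergSzegedyUmans2005_lemma2_abelian`, and at
  `s = ω`: `CohnKleinbergSzegedyUmans2005_lemma2_abelian_omega`.
  -- TODO(general form): non-abelian `H` (right-hand side `(n!)^{s−1}(Σ_k d_k^s)ⁿ`) needs induced characters
  -- (it follows from Frobenius reciprocity for the index-`n!` subgroup `Hⁿ`); not asserted here.

## References
* H. Cohn, C. Umans, FOCS 2003; arXiv:math/0307321, §4, Cor. 4.2 (proof). [CohnUmans2003]
* H. Cohn, R. Kleinberg, B. Szegedy, C. Umans, FOCS 2005; arXiv:math/0511460, Lemma 2 (arXiv numbering, p. 3 of the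
  held text), proof sketch. [CohnKleinbergSzegedyUmans2005]
-/

noncomputable section

namespace Literature.Computability.AlgebraicComplexity

open Finset Literature.RepresentationTheory.FiniteGroups

/-- **`Σ_χ χ(1)^s ≤ d_max^{s−2}·|G|`** for a finite group and real `s ≥ 2` — the step "`Σᵢ dᵢ^{ω−2}dᵢ² ≤
|G|^{(ω−2)/γ} Σᵢ dᵢ²`" of Cohn–Umans' Cor. 4.2, from `∑ χ(1)² = |G|` (`sum_sq_charDegrees_holds`).
[cite: CohnUmans2003, Cor. 4.2 (proof; Cor. 8 of the arXiv text, p. 6)] -/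
theorem charDegreePowSum_le_maxCharDegree_rpow_mul_card (G : Type) [Group G] [Finite G] {s : ℝ}
    (hs : 2 ≤ s) : charDegreePowSum G s ≤ (maxCharDegree G : ℝ) ^ (s - 2) * Nat.card G := by
  classical
  have hfin : (irrChars G).Finite := irrChars_finite_holds G
  have hdeg : ∀ χ ∈ hfin.toFinset, ∃ d ∈ charDegrees G, χ 1 = d := fun χ hχ =>
    IsIrrChar.exists_apply_one (hfin.mem_toFinset.mp hχ)
  choose! deg hdegmem hdeg using hdeg
  -- `Σ deg² = |G|`
  have hsum := sum_sq_charDegrees_holds G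
  rw [finsum_mem_eq_finite_toFinset_sum _ hfin] at hsum
  have hsumN : ((∑ χ ∈ hfin.toFinset, deg χ ^ 2 : ℕ) : ℂ) = (Nat.card G : ℂ) := by
    rw [← hsum, Nat.cast_sum]
    refine Finset.sum_congr rfl fun χ hχ => ?_
    rw [Nat.cast_pow, ← hdeg χ hχ]
  have hsumN' : ∑ χ ∈ hfin.toFinset, deg χ ^ 2 = Nat.card G := by exact_mod_cast hsumN
  have hsumR : ∑ χ ∈ hfin.toFinset, ((deg χ : ℕ) : ℝ) ^ 2 = (Nat.card G : ℝ) := by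
    exact_mod_cast congrArg (Nat.cast (R := ℝ)) hsumN'
  -- termwise bound `d^s ≤ d_max^{s−2} d²`
  have hdmax : ∀ χ ∈ hfin.toFinset, deg χ ≤ maxCharDegree G := fun χ hχ =>
    le_maxCharDegree (bddAbove_charDegrees' G) (hdegmem χ hχ)
  have hterm : ∀ χ ∈ hfin.toFinset,
      (χ 1).re ^ s ≤ (maxCharDegree G : ℝ) ^ (s - 2) * ((deg χ : ℕ) : ℝ) ^ 2 := by
    intro χ hχ
    rw [hdeg χ hχ, Complex.natCast_re]
    rcases Nat.eq_zero_or_pos (deg χ) with h0 | hpos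
    · rw [h0, Nat.cast_zero, Real.zero_rpow (by linarith)]
      positivity
    · have hd : (0 : ℝ) < deg χ := by exact_mod_cast hpos
      have hle : ((deg χ : ℕ) : ℝ) ≤ maxCharDegree G := by exact_mod_cast hdmax χ hχ
      calc ((deg χ : ℕ) : ℝ) ^ s = ((deg χ : ℕ) : ℝ) ^ (s - 2) * ((deg χ : ℕ) : ℝ) ^ (2 : ℝ) := by
            rw [← Real.rpow_add hd]; ring_nf
        _ ≤ (maxCharDegree G : ℝ) ^ (s - 2) * ((deg χ : ℕ) : ℝ) ^ (2 : ℝ) := by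
            gcongr
        _ = (maxCharDegree G : ℝ) ^ (s - 2) * ((deg χ : ℕ) : ℝ) ^ 2 := by norm_cast
  unfold charDegreePowSum
  rw [finsum_mem_eq_finite_toFinset_sum _ hfin]
  calc ∑ χ ∈ hfin.toFinset, (χ 1).re ^ s
      ≤ ∑ χ ∈ hfin.toFinset, (maxCharDegree G : ℝ) ^ (s - 2) * ((deg χ : ℕ) : ℝ) ^ 2 :=
        Finset.sum_le_sum hterm
    _ = (maxCharDegree G : ℝ) ^ (s - 2) * Nat.card G := by rw [← Finset.mul_sum, hsumR]

/-- **CKSU 2005, Lemma 2 (arXiv numbering), abelian case, as sketched**: for a finite abelian `H` and real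
`s ≥ 2`, the character degrees `c_j` of `Sym_n ⋉ Hⁿ` satisfy `Σ_j c_j^s ≤ (n!)^{s−1} |H|ⁿ` (`= (n!)^{s−1}(Σ_k d_k^s)ⁿ`,
all `d_k = 1`) — "the character degrees of `Sym_n ⋉ Hⁿ` are at most `n!` … and `Σ_j c_j² = |Sym_n ⋉ Hⁿ|`".
[cite: CohnKleinbergSzegedyUmans2005, Lemma 2 (arXiv numbering), proof sketch] -/
theorem CohnKleinbergSzegedyUmans2005_lemma2_abelian {H : Type} [AddCommGroup H] [Fintype H] [DecidableEq H]
    {n : ℕ} {s : ℝ} (hs : 2 ≤ s) :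
    charDegreePowSum (SymWreath H n) s ≤ (n.factorial : ℝ) ^ (s - 1) * (Fintype.card H : ℝ) ^ n := by
  have h1 := charDegreePowSum_le_maxCharDegree_rpow_mul_card (SymWreath H n) hs
  rw [SymWreath.card_symWreath] at h1
  have hdmax : (maxCharDegree (SymWreath H n) : ℝ) ≤ n.factorial := by
    exact_mod_cast SymWreath.maxCharDegree_symWreath_le
  have hfpos : (0 : ℝ) < n.factorial := by exact_mod_cast Nat.factorial_pos n
  refine h1.trans ?_
  push_cast
  calc (maxCharDegree (SymWreath H n) : ℝ) ^ (s - 2) * ((Fintype.card H : ℝ) ^ n * n.factorial)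
      ≤ (n.factorial : ℝ) ^ (s - 2) * ((Fintype.card H : ℝ) ^ n * n.factorial) := by
        gcongr
    _ = (n.factorial : ℝ) ^ (s - 2 + 1) * (Fintype.card H : ℝ) ^ n := by
        rw [Real.rpow_add hfpos, Real.rpow_one]; ring
    _ = (n.factorial : ℝ) ^ (s - 1) * (Fintype.card H : ℝ) ^ n := by ring_nf

/-- CKSU's Lemma 2 (abelian case) at the exponent it is printed with, `s = ω`:
`Σ_j c_j^ω ≤ (n!)^{ω−1} |H|ⁿ` for `Sym_n ⋉ Hⁿ`, `H` finite abelian.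
[cite: CohnKleinbergSzegedyUmans2005, Lemma 2 (arXiv numbering)] -/
theorem CohnKleinbergSzegedyUmans2005_lemma2_abelian_omega {H : Type} [AddCommGroup H] [Fintype H]
    [DecidableEq H] {n : ℕ} :
    charDegreePowSum (SymWreath H n) (omega ℂ) ≤
      (n.factorial : ℝ) ^ (omega ℂ - 1) * (Fintype.card H : ℝ) ^ n :=
  CohnKleinbergSzegedyUmans2005_lemma2_abelian (omega_two_le ℂ)

end Literature.Computability.AlgebraicComplexity

end
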